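import Literature.RepresentationTheory.CompactGroups.CharacterMultiplicity
import HarnessLib

/-!
# The character projector `P_τ = dim τ · ∫ conj χ_τ(g) π(g) dg` of a unitary representation of a compact group

Topic `Literature/RepresentationTheory/CompactGroups`; namespace `Literature.RepresentationTheory.CompactGroups.Schur`
(continues `SchurOrthogonality`, `CharacterMultiplicity`).  Theorems and two auxiliary definitions (`charProj`,
`charProjL`); no named fact.

T. Bröcker, T. tom Dieck, *Representations of Compact Lie Groups* (GTM 98, 1985), II (4.16) (PDF pp. 80–81) and
III (5.9)–(5.10) (PDF pp. 134–135); A. Deitmar, S. Echterhoff, *Principles of Harmonic Analysis* (2nd ed. 2014),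
Prop. 7.3.3.  For an irreducible unitary representation `τ` of the compact group `G` on `E` (`|τ| = dim E`, character
`χ_τ`) the orthogonality relations II (4.5)/(4.6) give the convolution identities II (4.16)(iii)
`χ_τ * χ_τ = χ_τ / |τ|`, `χ_τ * χ_σ = 0` (`σ ≇ τ` irreducible unitary), and II (4.16)(iv)-type identities
`|τ| ∫ conj χ_τ(g) τ(g) dg = id_E`, `∫ conj χ_τ(g) σ(g) dg = 0`; consequently, for ANY unitary representation `π` of
`G` on a Hilbert space `H` with continuous orbit maps, the bounded operator
`P_τ v = |τ| ∫ conj χ_τ(g) π(g) v dg` (the operator `e_χ * —` of III (5.9)–(5.10), `e_χ = |τ| conj χ_τ` under the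
book's convention; Deitmar–Echterhoff Prop. 7.3.3) is `G`-equivariant (III Lemma (5.5)), self-adjoint (III Lemma
(5.4)), is the identity on the image of every `G`-map `τ → π` and kills the image of every `G`-map `σ → π` from an
irreducible `σ ≇ τ` — the operator half of III Thm. (5.10)(i) ("`P_χ` is the projection onto the isotypical
summand"); the identification of its range with the isotypic component is not in this file.

* `Schur.continuous_character`, `Schur.norm_character_le` (`|χ_τ(g)| ≤ dim E` for unitary `τ`);
* `Schur.integral_character_mul_character_inv_mul` — **II (4.16)(iii)**: `∫ χ_τ(g) χ_τ(g⁻¹ k) dμ = χ_τ(k) / dim E`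
  (irreducible unitary `τ`); `Schur.integral_character_mul_character_inv_mul_eq_zero` — `= 0` for irreducible
  unitary `σ ≇ τ` in the second factor;
* `Schur.finrank_smul_integral_conj_character_smul_apply` — `dim E • ∫ conj χ_τ(g) • τ g x dμ = x` (irreducible
  unitary `τ`); `Schur.integral_conj_character_smul_apply_eq_zero` — `∫ conj χ_τ(g) • σ g y dμ = 0` (`σ ≇ τ`);
* `Schur.charProj μ τ π v = dim E • ∫ conj χ_τ(g) • π g v dμ` on a Hilbert space, bundled as the bounded operator
  `Schur.charProjL` (`‖P_τ v‖ ≤ (dim E)² ‖v‖`); `Schur.apply_charProj` — **III (5.5)** equivariance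
  `π k (P_τ v) = P_τ (π k v)` (left and right invariance of `μ`, `χ_τ` a class function); `Schur.inner_charProj_comm`
  — **III (5.4)** self-adjointness (inversion invariance of `μ`, `χ_τ(g⁻¹) = conj χ_τ(g)`);
  `Schur.charProj_apply_of_comm` — `P_τ (T x) = T x` for every intertwiner `T : τ → π`;
  `Schur.charProj_apply_of_comm_eq_zero` — `P_τ (S y) = 0` for every intertwiner `S : σ → π`, `σ ≇ τ` irreducible;
  `Schur.charProj_eq_self_of_mem_closure_span` — `P_τ = id` on the closed span of the images of all `G`-maps `τ → π`
  (**III (5.10)(i)**, operator half).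

## References
* T. Bröcker, T. tom Dieck, *Representations of Compact Lie Groups*, GTM 98 (1985), II (4.16), III (5.4), (5.5),
  (5.9), (5.10), PDF pp. 80–81, 134–135 [BrockerTomDieck1985].
* A. Deitmar, S. Echterhoff, *Principles of Harmonic Analysis*, 2nd ed. (2014), §7.3, Prop. 7.3.3 [DeitmarEchterhoff2014].

## Provenance
Lane `lit-hodgefound` (HOME `run/shared/lean/pub/lit-hodgefound/`), prover seat `lit-hodgefound-p05` generation 6 (Layer 0:
compact groups — isotypic projectors / multiplicities of `K`-types).  The tree's `CompactGroups/IsotypicProjection`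
treats ONE-dimensional characters (`ω : K →* (E ≃ₗᵢ[ℂ] E)`, `χ : K →* Circle`) and lists "characters of dimension
`> 1`" under *Not here*; the tree's `NumberTheory/Automorphic/UnitaryIsotypicProjection` avoids Haar measure
altogether.  This file supplies the Haar-integral projector for irreducible characters of any dimension.
-/

noncomputable section

open MeasureTheory ContinuousLinearMap Complex
open scoped InnerProductSpace ComplexConjugate

namespace Literature.RepresentationTheory.CompactGroups

namespace Schur

variable {G : Type*} [Group G] [TopologicalSpace G] [IsTopologicalGroup G] [MeasurableSpace G] [BorelSpace G]
  [CompactSpace G]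
variable {E F : Type*} [NormedAddCommGroup E] [InnerProductSpace ℂ E] [FiniteDimensional ℂ E]
  [NormedAddCommGroup F] [InnerProductSpace ℂ F] [FiniteDimensional ℂ F]
variable (μ : Measure G) [IsProbabilityMeasure μ] [μ.IsMulLeftInvariant]
variable {π : ContRepresentation ℂ G E} {σ : ContRepresentation ℂ G F}

/-! ### Characters are continuous and bounded by the dimension -/

omit [IsTopologicalGroup G] [MeasurableSpace G] [BorelSpace G] [CompactSpace G] in
/-- The character of a norm-continuous finite-dimensional representation is continuous (`χ = Tr ∘ π`).
[cite: BrockerTomDieck1985, II Prop (4.10)] -/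
theorem continuous_character (hπ : Continuous (π : G → E →L[ℂ] E)) : Continuous (character π) := by
  have h : character π = fun g => traceCLM E (π g) := rfl
  rw [h]
  exact (traceCLM E).continuous.comp hπ

omit [TopologicalSpace G] [IsTopologicalGroup G] [MeasurableSpace G] [BorelSpace G] [CompactSpace G]
  [FiniteDimensional ℂ E] in
/-- A unitary operator of the representation is an isometry: `‖π g v‖ = ‖v‖`. [cite: BrockerTomDieck1985, II (1.8)] -/
theorem norm_apply_eq (hu : ∀ (g : G) (v w : E), ⟪π g v, π g w⟫_ℂ = ⟪v, w⟫_ℂ) (g : G) (v : E) : ‖π g v‖ = ‖v‖ := by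
  rw [@norm_eq_sqrt_re_inner ℂ, @norm_eq_sqrt_re_inner ℂ, hu]

omit [TopologicalSpace G] [IsTopologicalGroup G] [MeasurableSpace G] [BorelSpace G] [CompactSpace G] in
/-- **`|χ_π(g)| ≤ dim E`** for a unitary `π` (`χ_π(g) = Σ ⟪b i, π g (b i)⟫` over an orthonormal basis and Cauchy–Schwarz).
[cite: BrockerTomDieck1985, II Prop (4.10)] -/
theorem norm_character_le (hu : ∀ (g : G) (v w : E), ⟪π g v, π g w⟫_ℂ = ⟪v, w⟫_ℂ) (g : G) :
    ‖character π g‖ ≤ Module.finrank ℂ E := by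
  classical
  set b := stdOrthonormalBasis ℂ E with hb
  rw [character_eq_sum_inner b]
  calc ‖∑ i, ⟪b i, π g (b i)⟫_ℂ‖ ≤ ∑ i, ‖⟪b i, π g (b i)⟫_ℂ‖ := norm_sum_le _ _
    _ ≤ ∑ _i : Fin (Module.finrank ℂ E), (1 : ℝ) := Finset.sum_le_sum fun i _ => by
        calc ‖⟪b i, π g (b i)⟫_ℂ‖ ≤ ‖b i‖ * ‖π g (b i)‖ := norm_inner_le_norm _ _
          _ = 1 := by rw [norm_apply_eq hu, b.orthonormal.1 i, mul_one]
    _ = Module.finrank ℂ E := by simp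

/-! ### The convolution identities for irreducible characters (II (4.16)(iii)) -/

/-- **Bröcker–tom Dieck II (4.16)(iii)**: `χ_τ * χ_τ = χ_τ / |τ|` for an irreducible unitary `τ`, i.e.
`∫ χ_τ(g) χ_τ(g⁻¹ k) dμ(g) = χ_τ(k) / dim E` (from II (4.5) summed over an orthonormal basis).
[cite: BrockerTomDieck1985, II Prop (4.16)] -/
theorem integral_character_mul_character_inv_mul (hπ : Continuous (π : G → E →L[ℂ] E))
    [π.toRepresentation.IsIrreducible] (hu : ∀ (g : G) (v w : E), ⟪π g v, π g w⟫_ℂ = ⟪v, w⟫_ℂ) (k : G) :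
    ∫ g, character π g * character π (g⁻¹ * k) ∂μ = character π k / (Module.finrank ℂ E : ℂ) := by
  classical
  set c := stdOrthonormalBasis ℂ E with hc
  have h1 : ∀ (g : G) (j : Fin (Module.finrank ℂ E)),
      ⟪c j, π (g⁻¹ * k) (c j)⟫_ℂ = conj ⟪π k (c j), π g (c j)⟫_ℂ := fun g j => by
    rw [map_mul, ContinuousLinearMap.mul_def, ContinuousLinearMap.comp_apply, inner_apply_inv_eq_conj hu]
  have hint : ∀ j i, Integrable (fun g : G => conj ⟪π k (c j), π g (c j)⟫_ℂ * ⟪c i, π g (c i)⟫_ℂ) μ :=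
    fun j i => integrable_conj_inner_mul_inner μ hπ hπ _ _ _ _
  calc ∫ g, character π g * character π (g⁻¹ * k) ∂μ
      = ∫ g, ∑ j, ∑ i, conj ⟪π k (c j), π g (c j)⟫_ℂ * ⟪c i, π g (c i)⟫_ℂ ∂μ := by
        refine integral_congr_ae (Filter.Eventually.of_forall fun g => ?_)
        beta_reduce
        rw [character_eq_sum_inner c g, character_eq_sum_inner c (g⁻¹ * k), mul_comm, Finset.sum_mul_sum]
        simp_rw [h1]
    _ = ∑ j, ∑ i, ∫ g, conj ⟪π k (c j), π g (c j)⟫_ℂ * ⟪c i, π g (c i)⟫_ℂ ∂μ := by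
        rw [integral_finsetSum _ fun j _ => integrable_finsetSum _ fun i _ => hint j i]
        exact Finset.sum_congr rfl fun j _ => integral_finsetSum _ fun i _ => hint j i
    _ = ∑ j, ∑ i, ⟪c j, c i⟫_ℂ * ⟪c i, π k (c j)⟫_ℂ / (Module.finrank ℂ E : ℂ) := by
        simp_rw [integral_conj_inner_mul_inner μ hπ hu]
    _ = ∑ j, ⟪c j, π k (c j)⟫_ℂ / (Module.finrank ℂ E : ℂ) := by
        refine Finset.sum_congr rfl fun j _ => ?_
        rw [← Finset.sum_div, c.sum_inner_mul_inner]
    _ = character π k / (Module.finrank ℂ E : ℂ) := by rw [← Finset.sum_div, ← character_eq_sum_inner c k]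

/-- **Bröcker–tom Dieck II (4.16)(iii), non-isomorphic classes**: `χ_τ * χ_σ = 0`, i.e. `∫ χ_τ(g) χ_σ(g⁻¹ k) dμ(g) = 0`
for irreducible `τ` and irreducible unitary `σ ≇ τ` (from II (4.6)). [cite: BrockerTomDieck1985, II Prop (4.16)] -/
theorem integral_character_mul_character_inv_mul_eq_zero (hπ : Continuous (π : G → E →L[ℂ] E))
    (hσ : Continuous (σ : G → F →L[ℂ] F)) [π.toRepresentation.IsIrreducible] [σ.toRepresentation.IsIrreducible]
    (hne : IsEmpty (π.toRepresentation.Equiv σ.toRepresentation))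
    (hσu : ∀ (g : G) (v w : F), ⟪σ g v, σ g w⟫_ℂ = ⟪v, w⟫_ℂ) (k : G) :
    ∫ g, character π g * character σ (g⁻¹ * k) ∂μ = 0 := by
  classical
  set c := stdOrthonormalBasis ℂ E with hc
  set d := stdOrthonormalBasis ℂ F with hd
  have hne' : IsEmpty (σ.toRepresentation.Equiv π.toRepresentation) := ⟨fun e => hne.false e.symm⟩
  have h1 : ∀ (g : G) (j : Fin (Module.finrank ℂ F)),
      ⟪d j, σ (g⁻¹ * k) (d j)⟫_ℂ = conj ⟪σ k (d j), σ g (d j)⟫_ℂ := fun g j => by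
    rw [map_mul, ContinuousLinearMap.mul_def, ContinuousLinearMap.comp_apply, inner_apply_inv_eq_conj hσu]
  have hint : ∀ j i, Integrable (fun g : G => conj ⟪σ k (d j), σ g (d j)⟫_ℂ * ⟪c i, π g (c i)⟫_ℂ) μ :=
    fun j i => integrable_conj_inner_mul_inner μ hσ hπ _ _ _ _
  calc ∫ g, character π g * character σ (g⁻¹ * k) ∂μ
      = ∫ g, ∑ j, ∑ i, conj ⟪σ k (d j), σ g (d j)⟫_ℂ * ⟪c i, π g (c i)⟫_ℂ ∂μ := by
        refine integral_congr_ae (Filter.Eventually.of_forall fun g => ?_)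
        beta_reduce
        rw [character_eq_sum_inner c g, character_eq_sum_inner d (g⁻¹ * k), mul_comm, Finset.sum_mul_sum]
        simp_rw [h1]
    _ = ∑ j, ∑ i, ∫ g, conj ⟪σ k (d j), σ g (d j)⟫_ℂ * ⟪c i, π g (c i)⟫_ℂ ∂μ := by
        rw [integral_finsetSum _ fun j _ => integrable_finsetSum _ fun i _ => hint j i]
        exact Finset.sum_congr rfl fun j _ => integral_finsetSum _ fun i _ => hint j i
    _ = 0 := Finset.sum_eq_zero fun j _ => Finset.sum_eq_zero fun i _ =>
        integral_conj_inner_mul_inner_eq_zero μ hσ hπ hne' hσu _ _ _ _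

/-! ### `dim E • ∫ conj χ_τ(g) • τ g x dμ = x` and `∫ conj χ_τ(g) • σ g y dμ = 0` (II (4.16)(iv)) -/

omit [IsTopologicalGroup G] [FiniteDimensional ℂ F] [μ.IsMulLeftInvariant] in
/-- Integrability of `g ↦ conj χ_τ(g) • σ g y` on the compact group. [cite: BrockerTomDieck1985, III (5.9)] -/
theorem integrable_conj_character_smul_apply (hπ : Continuous (π : G → E →L[ℂ] E))
    (hσ : Continuous (σ : G → F →L[ℂ] F)) (y : F) :
    Integrable (fun g : G => conj (character π g) • σ g y) μ :=
  ((continuous_conj.comp (continuous_character hπ)).smul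
    ((ContinuousLinearMap.apply ℂ F y).continuous.comp hσ)).integrable_of_hasCompactSupport
    (HasCompactSupport.of_compactSpace _)

/-- **`dim E • ∫ conj χ_τ(g) • τ g x dμ = x` for an irreducible unitary `τ`** (Bröcker–tom Dieck II (4.16)(iv):
`|U| χ_U * f = f` on the span of the coefficients of `U`; here on the representation space itself, from II (4.5):
`⟪w, dim E ∫ conj χ τ g x⟫ = Σ_k dim E ∫ conj⟪b k, τ g b k⟫ ⟪w, τ g x⟫ = Σ_k ⟪w, b k⟫⟪b k, x⟫ = ⟪w, x⟫`).
[cite: BrockerTomDieck1985, II Prop (4.16)] -/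
theorem finrank_smul_integral_conj_character_smul_apply (hπ : Continuous (π : G → E →L[ℂ] E))
    [π.toRepresentation.IsIrreducible] (hu : ∀ (g : G) (v w : E), ⟪π g v, π g w⟫_ℂ = ⟪v, w⟫_ℂ) (x : E) :
    (Module.finrank ℂ E : ℂ) • ∫ g, conj (character π g) • π g x ∂μ = x := by
  classical
  haveI : CompleteSpace E := FiniteDimensional.complete ℂ E
  set b := stdOrthonormalBasis ℂ E with hb
  refine ext_inner_left ℂ fun w => ?_
  rw [inner_smul_right, ← integral_inner (integrable_conj_character_smul_apply μ hπ hπ x)]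
  simp_rw [inner_smul_right, character_eq_sum_inner b, map_sum, Finset.sum_mul]
  rw [integral_finsetSum _ fun k _ => integrable_conj_inner_mul_inner μ hπ hπ _ _ _ _]
  simp_rw [integral_conj_inner_mul_inner μ hπ hu]
  rw [← Finset.sum_div, ← mul_div_assoc, mul_div_cancel_left₀ _ (finrank_ne_zero_of_isIrreducible π)]
  simp_rw [mul_comm ⟪b _, x⟫_ℂ]
  exact b.sum_inner_mul_inner w x

/-- **`∫ conj χ_τ(g) • σ g y dμ = 0` for irreducible unitary `τ` and irreducible `σ ≇ τ`** (Bröcker–tom Dieck II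
(4.16)(ii)/(iv): `u * v = 0` across non-isomorphic classes; from II (4.6)). [cite: BrockerTomDieck1985, II Prop (4.16)] -/
theorem integral_conj_character_smul_apply_eq_zero (hπ : Continuous (π : G → E →L[ℂ] E))
    (hσ : Continuous (σ : G → F →L[ℂ] F)) [π.toRepresentation.IsIrreducible] [σ.toRepresentation.IsIrreducible]
    (hne : IsEmpty (π.toRepresentation.Equiv σ.toRepresentation))
    (hu : ∀ (g : G) (v w : E), ⟪π g v, π g w⟫_ℂ = ⟪v, w⟫_ℂ) (y : F) :
    ∫ g, conj (character π g) • σ g y ∂μ = 0 := by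
  classical
  haveI : CompleteSpace F := FiniteDimensional.complete ℂ F
  set b := stdOrthonormalBasis ℂ E with hb
  refine ext_inner_left ℂ fun w => ?_
  rw [inner_zero_right, ← integral_inner (integrable_conj_character_smul_apply μ hπ hσ y)]
  simp_rw [inner_smul_right, character_eq_sum_inner b, map_sum, Finset.sum_mul]
  rw [integral_finsetSum _ fun k _ => integrable_conj_inner_mul_inner μ hπ hσ _ _ _ _]
  exact Finset.sum_eq_zero fun k _ => integral_conj_inner_mul_inner_eq_zero μ hπ hσ hne hu _ _ _ _

/-! ### The character projector on a unitary representation on a Hilbert space (III (5.9)–(5.10)) -/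

section Hilbert

variable {H : Type*} [NormedAddCommGroup H] [InnerProductSpace ℂ H] [CompleteSpace H]
variable {U : ContRepresentation ℂ G H}

variable (π U) in
/-- **The character projector** `P_τ v = dim E • ∫ conj χ_τ(g) • U g v dμ(g)` of a representation `U` on a Hilbert
space along an irreducible character `χ_τ` (Bröcker–tom Dieck III (5.9)–(5.10): `v ↦ e_χ * v`; Deitmar–Echterhoff
Prop. 7.3.3). [cite: BrockerTomDieck1985, III (5.10)] -/
def charProj (v : H) : H := (Module.finrank ℂ E : ℂ) • ∫ g, conj (character π g) • U g v ∂μ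

omit [TopologicalSpace G] [IsTopologicalGroup G] [BorelSpace G] [CompactSpace G] [FiniteDimensional ℂ E]
  [IsProbabilityMeasure μ] [μ.IsMulLeftInvariant] [CompleteSpace H] in
/-- Unfolding `charProj`. [cite: BrockerTomDieck1985, III (5.10)] -/
theorem charProj_def (v : H) :
    charProj μ π U v = (Module.finrank ℂ E : ℂ) • ∫ g, conj (character π g) • U g v ∂μ := rfl

omit [IsTopologicalGroup G] [μ.IsMulLeftInvariant] [CompleteSpace H] in
/-- Integrability of `g ↦ conj χ_τ(g) • U g v` for continuous orbit maps. [cite: BrockerTomDieck1985, III (5.9)] -/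
theorem integrable_conj_character_smul_orbit (hπ : Continuous (π : G → E →L[ℂ] E))
    (hU : ∀ v : H, Continuous fun g : G => U g v) (v : H) :
    Integrable (fun g : G => conj (character π g) • U g v) μ :=
  ((continuous_conj.comp (continuous_character hπ)).smul (hU v)).integrable_of_hasCompactSupport
    (HasCompactSupport.of_compactSpace _)

omit [IsTopologicalGroup G] [μ.IsMulLeftInvariant] [CompleteSpace H] in
/-- `charProj` is additive. [cite: BrockerTomDieck1985, III (5.10)] -/
theorem charProj_add (hπ : Continuous (π : G → E →L[ℂ] E)) (hU : ∀ v : H, Continuous fun g : G => U g v)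
    (v w : H) : charProj μ π U (v + w) = charProj μ π U v + charProj μ π U w := by
  simp only [charProj_def, map_add, smul_add]
  rw [integral_add (integrable_conj_character_smul_orbit μ hπ hU v) (integrable_conj_character_smul_orbit μ hπ hU w),
    smul_add]

omit [TopologicalSpace G] [IsTopologicalGroup G] [BorelSpace G] [CompactSpace G] [FiniteDimensional ℂ E]
  [IsProbabilityMeasure μ] [μ.IsMulLeftInvariant] [CompleteSpace H] in
/-- `charProj` is homogeneous. [cite: BrockerTomDieck1985, III (5.10)] -/
theorem charProj_smul (c : ℂ) (v : H) : charProj μ π U (c • v) = c • charProj μ π U v := by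
  simp only [charProj_def, map_smul]
  simp_rw [smul_comm (conj (character π _)) c (U _ v)]
  rw [integral_smul, smul_comm]

omit [TopologicalSpace G] [IsTopologicalGroup G] [BorelSpace G] [CompactSpace G] [μ.IsMulLeftInvariant]
  [CompleteSpace H] in
/-- **`P_τ` is bounded**: `‖P_τ v‖ ≤ (dim E)² ‖v‖` for unitary `τ` and `U` (`|χ_τ| ≤ dim E`, `‖U g v‖ = ‖v‖`, `μ` a
probability measure). [cite: BrockerTomDieck1985, III (5.10)] -/
theorem norm_charProj_le (hu : ∀ (g : G) (v w : E), ⟪π g v, π g w⟫_ℂ = ⟪v, w⟫_ℂ)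
    (hUu : ∀ (g : G) (v w : H), ⟪U g v, U g w⟫_ℂ = ⟪v, w⟫_ℂ) (v : H) :
    ‖charProj μ π U v‖ ≤ (Module.finrank ℂ E : ℝ) * ((Module.finrank ℂ E : ℝ) * ‖v‖) := by
  rw [charProj_def, norm_smul, Complex.norm_natCast]
  refine mul_le_mul_of_nonneg_left ?_ (Nat.cast_nonneg _)
  have h := norm_integral_le_of_norm_le_const (μ := μ) (f := fun g : G => conj (character π g) • U g v)
    (C := (Module.finrank ℂ E : ℝ) * ‖v‖) (Filter.Eventually.of_forall fun g => by
      rw [norm_smul, RCLike.norm_conj, norm_apply_eq hUu]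
      exact mul_le_mul_of_nonneg_right (norm_character_le hu g) (norm_nonneg _))
  simpa using h

variable (π U) in
/-- The character projector as a bounded operator on `H` (unitary `τ`, `U` with continuous orbit maps).
[cite: BrockerTomDieck1985, III (5.10)] -/
def charProjL (hπ : Continuous (π : G → E →L[ℂ] E)) (hu : ∀ (g : G) (v w : E), ⟪π g v, π g w⟫_ℂ = ⟪v, w⟫_ℂ)
    (hU : ∀ v : H, Continuous fun g : G => U g v) (hUu : ∀ (g : G) (v w : H), ⟪U g v, U g w⟫_ℂ = ⟪v, w⟫_ℂ) :
    H →L[ℂ] H :=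
  LinearMap.mkContinuous
    { toFun := charProj μ π U
      map_add' := charProj_add μ hπ hU
      map_smul' := charProj_smul μ }
    ((Module.finrank ℂ E : ℝ) * (Module.finrank ℂ E : ℝ)) fun v => by
      rw [mul_assoc]
      exact norm_charProj_le μ hu hUu v

omit [IsTopologicalGroup G] [μ.IsMulLeftInvariant] [CompleteSpace H] in
/-- Unfolding `charProjL`. [cite: BrockerTomDieck1985, III (5.10)] -/
@[simp] theorem charProjL_apply (hπ : Continuous (π : G → E →L[ℂ] E))
    (hu : ∀ (g : G) (v w : E), ⟪π g v, π g w⟫_ℂ = ⟪v, w⟫_ℂ) (hU : ∀ v : H, Continuous fun g : G => U g v)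
    (hUu : ∀ (g : G) (v w : H), ⟪U g v, U g w⟫_ℂ = ⟪v, w⟫_ℂ) (v : H) :
    charProjL μ π U hπ hu hU hUu v = charProj μ π U v := rfl

/-- **Equivariance, Bröcker–tom Dieck III Lemma (5.5)**: `U k (P_τ v) = P_τ (U k v)` (left and right invariance of
`μ`; `χ_τ` is a class function: `χ_τ(k⁻¹ g) = χ_τ(g k⁻¹)`). [cite: BrockerTomDieck1985, III (5.5)] -/
theorem apply_charProj [μ.IsMulRightInvariant] (hπ : Continuous (π : G → E →L[ℂ] E))
    (hU : ∀ v : H, Continuous fun g : G => U g v) (k : G) (v : H) :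
    U k (charProj μ π U v) = charProj μ π U (U k v) := by
  rw [charProj_def, charProj_def, map_smul,
    ← (U k).integral_comp_comm (integrable_conj_character_smul_orbit μ hπ hU v)]
  congr 1
  -- left-hand side: substitute `g ↦ k⁻¹ g` (left invariance)
  have hL : ∫ g, U k (conj (character π g) • U g v) ∂μ = ∫ g, conj (character π (k⁻¹ * g)) • U g v ∂μ := by
    have h := integral_mul_left_eq_self (μ := μ) (fun g : G => conj (character π (k⁻¹ * g)) • U g v) k
    rw [← h]
    refine integral_congr_ae (Filter.Eventually.of_forall fun g => ?_)
    simp only [map_smul, inv_mul_cancel_left, map_mul, ContinuousLinearMap.mul_def, ContinuousLinearMap.comp_apply]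
  -- right-hand side: substitute `g ↦ g k⁻¹` (right invariance)
  have hR : ∫ g, conj (character π g) • U g (U k v) ∂μ = ∫ g, conj (character π (g * k⁻¹)) • U g v ∂μ := by
    have h := integral_mul_right_eq_self (μ := μ) (fun g : G => conj (character π (g * k⁻¹)) • U g v) k
    rw [← h]
    refine integral_congr_ae (Filter.Eventually.of_forall fun g => ?_)
    simp only [mul_inv_cancel_right, map_mul, ContinuousLinearMap.mul_def, ContinuousLinearMap.comp_apply]
  rw [hL, hR]
  refine integral_congr_ae (Filter.Eventually.of_forall fun g => ?_)
  simp only [character_eq_toRepresentation_character, Representation.char_mul_comm π.toRepresentation g k⁻¹]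

omit [IsTopologicalGroup G] [μ.IsMulLeftInvariant] in
/-- `⟪w, P_τ v⟫ = dim E · ∫ conj χ_τ(g) ⟪w, U g v⟫ dμ` (the inner product passes under the integral).
[cite: BrockerTomDieck1985, III (5.4)] -/
theorem inner_charProj (hπ : Continuous (π : G → E →L[ℂ] E)) (hU : ∀ v : H, Continuous fun g : G => U g v)
    (w v : H) :
    ⟪w, charProj μ π U v⟫_ℂ = (Module.finrank ℂ E : ℂ) * ∫ g, conj (character π g) * ⟪w, U g v⟫_ℂ ∂μ := by
  rw [charProj_def, inner_smul_right, ← integral_inner (integrable_conj_character_smul_orbit μ hπ hU v)]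
  simp_rw [inner_smul_right]

omit [μ.IsMulLeftInvariant] in
/-- **Self-adjointness, Bröcker–tom Dieck III Lemma (5.4)**: `⟪P_τ v, w⟫ = ⟪v, P_τ w⟫` for unitary `τ` and `U`
(inversion invariance of `μ` and `χ_τ(g⁻¹) = conj χ_τ(g)`, `⟪U g v, w⟫ = ⟪v, U g⁻¹ w⟫`).
[cite: BrockerTomDieck1985, III (5.4)] -/
theorem inner_charProj_comm [μ.IsInvInvariant] (hπ : Continuous (π : G → E →L[ℂ] E))
    (hu : ∀ (g : G) (v w : E), ⟪π g v, π g w⟫_ℂ = ⟪v, w⟫_ℂ) (hU : ∀ v : H, Continuous fun g : G => U g v)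
    (hUu : ∀ (g : G) (v w : H), ⟪U g v, U g w⟫_ℂ = ⟪v, w⟫_ℂ) (v w : H) :
    ⟪charProj μ π U v, w⟫_ℂ = ⟪v, charProj μ π U w⟫_ℂ := by
  rw [← inner_conj_symm, inner_charProj μ hπ hU, inner_charProj μ hπ hU, map_mul, Complex.conj_natCast,
    ← integral_conj, ← integral_inv_eq_self (fun g : G => conj (character π g) * ⟪v, U g w⟫_ℂ) μ]
  congr 1
  refine integral_congr_ae (Filter.Eventually.of_forall fun g => ?_)
  beta_reduce
  rw [map_mul, Complex.conj_conj, inner_conj_symm, character_inv hu, Complex.conj_conj, ← hUu g v (U g⁻¹ w),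
    apply_apply_inv]

/-- **`P_τ` is the identity on the image of every `G`-map `τ → U`** (Bröcker–tom Dieck III (5.10)(i), operator form:
for `T : E →L[ℂ] H` with `U g ∘ T = T ∘ τ g`, `P_τ (T x) = T (dim E ∫ conj χ_τ τ g x) = T x`).
[cite: BrockerTomDieck1985, III (5.10)] -/
theorem charProj_apply_of_comm (hπ : Continuous (π : G → E →L[ℂ] E)) [π.toRepresentation.IsIrreducible]
    (hu : ∀ (g : G) (v w : E), ⟪π g v, π g w⟫_ℂ = ⟪v, w⟫_ℂ) (T : E →L[ℂ] H)
    (hT : ∀ g : G, (U g).comp T = T.comp (π g)) (x : E) : charProj μ π U (T x) = T x := by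
  haveI : CompleteSpace E := FiniteDimensional.complete ℂ E
  have h1 : (fun g : G => conj (character π g) • U g (T x)) = fun g => T (conj (character π g) • π g x) := by
    funext g
    have h := congrArg (fun S : E →L[ℂ] H => S x) (hT g)
    simp only [ContinuousLinearMap.comp_apply] at h
    rw [h, map_smul]
  rw [charProj_def, h1, T.integral_comp_comm (integrable_conj_character_smul_apply μ hπ hπ x), ← map_smul,
    finrank_smul_integral_conj_character_smul_apply μ hπ hu]

/-- **`P_τ` kills the image of every `G`-map `σ → U` from an irreducible `σ ≇ τ`** (Bröcker–tom Dieck III (5.10)(i)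
with II (4.6)). [cite: BrockerTomDieck1985, III (5.10)] -/
theorem charProj_apply_of_comm_eq_zero (hπ : Continuous (π : G → E →L[ℂ] E))
    (hσ : Continuous (σ : G → F →L[ℂ] F)) [π.toRepresentation.IsIrreducible] [σ.toRepresentation.IsIrreducible]
    (hne : IsEmpty (π.toRepresentation.Equiv σ.toRepresentation))
    (hu : ∀ (g : G) (v w : E), ⟪π g v, π g w⟫_ℂ = ⟪v, w⟫_ℂ) (S : F →L[ℂ] H)
    (hS : ∀ g : G, (U g).comp S = S.comp (σ g)) (y : F) : charProj μ π U (S y) = 0 := by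
  haveI : CompleteSpace F := FiniteDimensional.complete ℂ F
  have h1 : (fun g : G => conj (character π g) • U g (S y)) = fun g => S (conj (character π g) • σ g y) := by
    funext g
    have h := congrArg (fun S' : F →L[ℂ] H => S' y) (hS g)
    simp only [ContinuousLinearMap.comp_apply] at h
    rw [h, map_smul]
  rw [charProj_def, h1, S.integral_comp_comm (integrable_conj_character_smul_apply μ hπ hσ y),
    integral_conj_character_smul_apply_eq_zero μ hπ hσ hne hu, map_zero, smul_zero]

/-- **`P_τ = id` on the closed span of the images of all `G`-maps `τ → U`** — the `τ`-isotypic summand in the sense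
of Bröcker–tom Dieck III (5.10)(i) (`P_τ` is bounded, so its fixed space is closed). [cite: BrockerTomDieck1985, III (5.10)] -/
theorem charProj_eq_self_of_mem_closure (hπ : Continuous (π : G → E →L[ℂ] E)) [π.toRepresentation.IsIrreducible]
    (hu : ∀ (g : G) (v w : E), ⟪π g v, π g w⟫_ℂ = ⟪v, w⟫_ℂ) (hU : ∀ v : H, Continuous fun g : G => U g v)
    (hUu : ∀ (g : G) (v w : H), ⟪U g v, U g w⟫_ℂ = ⟪v, w⟫_ℂ) {v : H}
    (hv : v ∈ (⨆ T : {T : E →L[ℂ] H // ∀ g : G, (U g).comp T = T.comp (π g)},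
      LinearMap.range ((T : E →L[ℂ] H) : E →ₗ[ℂ] H)).topologicalClosure) :
    charProj μ π U v = v := by
  -- the fixed space of the bounded operator `P_τ` is a closed submodule containing every `range T`
  let P : H →L[ℂ] H := charProjL μ π U hπ hu hU hUu
  let K : Submodule ℂ H := LinearMap.ker ((P : H →ₗ[ℂ] H) - LinearMap.id)
  have hK : IsClosed (K : Set H) := by
    have : (K : Set H) = {v | P v - v = 0} := by
      ext v
      simp [K, LinearMap.mem_ker, sub_eq_zero]
    rw [this]
    exact isClosed_eq (P.continuous.sub continuous_id) continuous_const
  have hle : (⨆ T : {T : E →L[ℂ] H // ∀ g : G, (U g).comp T = T.comp (π g)},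
      LinearMap.range ((T : E →L[ℂ] H) : E →ₗ[ℂ] H)) ≤ K := by
    refine iSup_le fun T => ?_
    rintro _ ⟨x, rfl⟩
    simp only [K, LinearMap.mem_ker, LinearMap.sub_apply, LinearMap.id_apply, ContinuousLinearMap.coe_coe, sub_eq_zero]
    exact charProj_apply_of_comm μ hπ hu T.1 T.2 x
  have hmem : v ∈ K := (Submodule.topologicalClosure_minimal _ hle hK) hv
  simpa [K, LinearMap.mem_ker, sub_eq_zero, P] using hmem

end Hilbert

end Schur

end Literature.RepresentationTheory.CompactGroups
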